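import Summits.ResolutionOfSingularities.ResolutionOfSingularities.Theorems.NoPeriodicIsolatedAtom.Negative.FalseWithoutIsol

/-!
# `NoPeriodicIsolatedAtom` (crux stmt-ResolutionOfSingularities-16344, route `FrobeniusClosing`):
# the binder `0 < r` is load-bearing — WITHOUT it the statement is FALSE (trivially), and the
# witness is the first `Isol` instance in the tree with a NON-TRIVIAL Jacobian ideal
# (negative-side support, crux-disprover seat; this file does NOT refute the crux)

Companion of `FalseWithoutIsol` (umbrella: `Isol` is load-bearing) and `FalseWithoutMultP` (regular
atom: `MultP` is load-bearing).  Dropping `0 < r` makes the conclusion `¬ PairIso (run 0) (run 0)`,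
which fails by reflexivity (`pairIso_refl`) at ANY start satisfying the chain hypothesis at `m = 0`,
i.e. at any isolated atom of multiplicity `p`.  The content of this file is therefore the WITNESS:
the cusp atom `z² = u³` over `𝔽₂` (`p = 2`, `n = 1`) is clean, of multiplicity `2`, and ISOLATED —
its Jacobian ideal is `(3u²) = (u²)` and `𝔽₂[[u]] ⧸ (u²)` is a finite `𝔽₂`-module (spanned by `1, u`;
μ = 2), proved from `MvPowerSeries.X_pow_dvd_iff`.  This completes the hypothesis census of the
crux (`Isol`, `MultP`, `0 < r` each load-bearing; `Algebra.IsAlgebraic` believed unnecessary — see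
the crux workfile `Cruxes/NoPeriodicIsolatedAtom/Disproof.lean`, §2–§3), and `finite_quot_X_sq` is a
reusable pattern for the `Isol` verifications provers of this crux will need.

The dynamics is the crux's own `let`-block via the exact mirror of `FalseWithoutIsol` (`crux_iff`);
the refuted proposition is the right-hand side of `crux_iff` with the binder `0 < r →` deleted and
nothing else changed (stated inline; the witness is written out as a lambda — no definition is declared).
-/

noncomputable section

-- single-problem summit: the doubled namespace component `ResolutionOfSingularities` is forced by the tree layout
set_option linter.dupNamespace false

namespace Summit.ResolutionOfSingularities.ResolutionOfSingularities.Theorems.NoPeriodicIsolatedAtom.Negative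

open Summit.ResolutionOfSingularities.ResolutionOfSingularities.Theses.FrobeniusClosing (NoPeriodicIsolatedAtom)
open scoped BigOperators Classical

-- The cusp start `u³` over `𝔽₂` in dimension `n = 1` (the atom `z² = u³`: isolated, multiplicity 2).

/-- `ucube` is supported exactly on the exponent `3`. [folklore] -/
lemma ucube_ne_zero_iff (A : Fin 1 → ℕ) : (fun A : Fin 1 → ℕ => if A = ![3] then (1 : ZMod 2) else 0) A ≠ 0 ↔ A = ![3] := by
  by_cases h : A = ![3] <;> simp [h]

/-- `u³` is `2`-clean. [folklore] -/
lemma clean_ucube : clean 2 (fun A : Fin 1 → ℕ => if A = ![3] then (1 : ZMod 2) else 0) = (fun A : Fin 1 → ℕ => if A = ![3] then (1 : ZMod 2) else 0) := by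
  funext A
  unfold clean
  by_cases h : ∀ j, 2 ∣ A j
  · rw [if_pos h]
    by_cases hA : A = ![3]
    · exact absurd (h 0) (by simp [hA])
    · simp [hA]
  · rw [if_neg h]

/-- `u³` has multiplicity `2`: clean, non-zero, its only monomial has degree `3 ≥ 2`. [folklore] -/
lemma multP_ucube :
    (∃ A, clean 2 (fun A : Fin 1 → ℕ => if A = ![3] then (1 : ZMod 2) else 0) A ≠ 0) ∧ ∀ A, clean 2 (fun A : Fin 1 → ℕ => if A = ![3] then (1 : ZMod 2) else 0) A ≠ 0 → 2 ≤ Finset.sum Finset.univ (fun j => A j) := by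
  rw [clean_ucube]
  refine ⟨⟨![3], by simp⟩, ?_⟩
  intro A hA
  rw [ucube_ne_zero_iff] at hA
  subst hA
  simp

/-- `∂(u³)/∂u = 3u² = u²` over `𝔽₂`. [folklore] -/
lemma pd_ucube : pd 0 (ser 2 (fun A : Fin 1 → ℕ => if A = ![3] then (1 : ZMod 2) else 0)) = MvPowerSeries.X 0 ^ 2 := by
  refine MvPowerSeries.ext fun A => ?_
  rw [MvPowerSeries.coeff_X_pow]
  change ((A 0 + 1 : ℕ) : ZMod 2) * clean 2 (fun A : Fin 1 → ℕ => if A = ![3] then (1 : ZMod 2) else 0) ((A + Finsupp.single (0 : Fin 1) 1 : Fin 1 →₀ ℕ) : Fin 1 → ℕ) = _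
  rw [clean_ucube]
  beta_reduce
  have key : (((A + Finsupp.single (0 : Fin 1) 1 : Fin 1 →₀ ℕ) : Fin 1 → ℕ) = ![3]) ↔
      A = Finsupp.single 0 2 := by
    constructor
    · intro h
      have h0 := congrFun h 0
      simp at h0
      refine Finsupp.ext fun j => ?_
      fin_cases j
      simp
      omega
    · rintro rfl
      funext j
      fin_cases j
      simp
  by_cases hA : A = Finsupp.single 0 2
  · rw [if_pos (key.mpr hA), if_pos hA, hA]
    simp
    decide
  · rw [if_neg (fun h => hA (key.mp h)), if_neg hA, mul_zero]

/-- The Jacobian ideal of `u³` over `𝔽₂` is `(u²)`. [folklore] -/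
lemma jac_ucube : jac 2 (fun A : Fin 1 → ℕ => if A = ![3] then (1 : ZMod 2) else 0) = Ideal.span {(MvPowerSeries.X 0 : MvPowerSeries (Fin 1) (ZMod 2)) ^ 2} := by
  unfold jac
  rw [Set.range_unique]
  show Ideal.span {pd (default : Fin 1) (ser 2 (fun A : Fin 1 → ℕ => if A = ![3] then (1 : ZMod 2) else 0))} = _
  rw [Fin.default_eq_zero, pd_ucube]

/-- `κ[[u]] ⧸ (u²)` is a finite `κ`-module (spanned by `1, u`): the first `Isol` instance with a
non-trivial Jacobian ideal, via `MvPowerSeries.X_pow_dvd_iff`. [folklore] -/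
lemma finite_quot_X_sq :
    Module.Finite (ZMod 2) (MvPowerSeries (Fin 1) (ZMod 2) ⧸
      Ideal.span {(MvPowerSeries.X 0 : MvPowerSeries (Fin 1) (ZMod 2)) ^ 2}) := by
  set R := MvPowerSeries (Fin 1) (ZMod 2) with hR
  set I : Ideal R := Ideal.span {(MvPowerSeries.X 0 : R) ^ 2} with hI
  refine ⟨⟨{(1 : R ⧸ I), Ideal.Quotient.mk I (MvPowerSeries.X 0)}, ?_⟩⟩
  rw [eq_top_iff]
  rintro q -
  obtain ⟨f, rfl⟩ := Ideal.Quotient.mk_surjective q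
  set f0 : ZMod 2 := MvPowerSeries.coeff (0 : Fin 1 →₀ ℕ) f with hf0
  set f1 : ZMod 2 := MvPowerSeries.coeff (Finsupp.single (0 : Fin 1) 1) f with hf1
  have hdvd : (MvPowerSeries.X 0 : R) ^ 2 ∣
      f - (MvPowerSeries.C f0 + MvPowerSeries.C f1 * MvPowerSeries.X 0) := by
    rw [MvPowerSeries.X_pow_dvd_iff]
    intro m hm
    have hm' : m = 0 ∨ m = Finsupp.single 0 1 := by
      have h01 : m 0 = 0 ∨ m 0 = 1 := by omega
      rcases h01 with h | h
      · left
        refine Finsupp.ext fun j => ?_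
        fin_cases j
        simpa using h
      · right
        refine Finsupp.ext fun j => ?_
        fin_cases j
        simpa using h
    rcases hm' with rfl | rfl
    · simp [hf0]
    · simp [hf1, MvPowerSeries.coeff_C, MvPowerSeries.coeff_X]
  obtain ⟨g, hg⟩ := hdvd
  have hf : f = (MvPowerSeries.C f0 + MvPowerSeries.C f1 * MvPowerSeries.X 0) + (MvPowerSeries.X 0) ^ 2 * g := by
    rw [← hg]; ring
  have hmem : (MvPowerSeries.X 0 : R) ^ 2 * g ∈ I := Ideal.mul_mem_right _ _ (Ideal.subset_span rfl)
  have h1 : Ideal.Quotient.mk I (MvPowerSeries.C f0) = f0 • (1 : R ⧸ I) := by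
    rw [MvPowerSeries.c_eq_algebraMap, Ideal.Quotient.mk_algebraMap, Algebra.algebraMap_eq_smul_one]
  have h2 : Ideal.Quotient.mk I (MvPowerSeries.C f1 * MvPowerSeries.X 0) =
      f1 • Ideal.Quotient.mk I (MvPowerSeries.X 0) := by
    rw [map_mul, MvPowerSeries.c_eq_algebraMap, Ideal.Quotient.mk_algebraMap, ← Algebra.smul_def]
  rw [hf, map_add, map_add, Ideal.Quotient.eq_zero_iff_mem.mpr hmem, add_zero, h1, h2]
  exact Submodule.add_mem _ (Submodule.smul_mem _ _ (Submodule.subset_span (by simp)))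
    (Submodule.smul_mem _ _ (Submodule.subset_span (by simp)))

/-- `u³` over `𝔽₂` is isolated: `κ[[u]] ⧸ (u²)` is finite over `κ` (μ = 2). [folklore] -/
lemma isol_ucube : Module.Finite (ZMod 2) (MvPowerSeries (Fin 1) (ZMod 2) ⧸ jac 2 (fun A : Fin 1 → ℕ => if A = ![3] then (1 : ZMod 2) else 0)) := by
  rw [jac_ucube]
  exact finite_quot_X_sq

/-- **`0 < r` is load-bearing in `NoPeriodicIsolatedAtom`.** The proposition below is the
right-hand side of `crux_iff` with the binder `0 < r →` deleted and nothing else changed; it is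
false at `r = 0` by reflexivity of `PairIso`, the chain hypothesis being met by the isolated
multiplicity-2 cusp atom `z² = u³` over `𝔽₂` (`n = 1`, μ = 2). [folklore] -/
theorem noPeriodicIsolatedAtom_false_without_rpos :
    ¬ ∀ p : ℕ, p.Prime → ∀ n : ℕ, 0 < n → ∀ (κ : Type) [Field κ] [Algebra (ZMod p) κ] [Algebra.IsAlgebraic (ZMod p) κ]
        (c₀ : (Fin n → ℕ) → κ) (i : ℕ → Fin n) (t : ℕ → Fin n → κ) (r : ℕ),
        (∀ m, m ≤ r →
          Module.Finite κ (MvPowerSeries (Fin n) κ ⧸ jac p (run p c₀ i t m)) ∧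
          ((∃ A, clean p (run p c₀ i t m) A ≠ 0) ∧
            ∀ A, clean p (run p c₀ i t m) A ≠ 0 → p ≤ Finset.sum Finset.univ (fun j => A j))) →
        ¬ ∃ (φ : MvPowerSeries (Fin n) κ ≃ₐ[κ] MvPowerSeries (Fin n) κ) (v g : MvPowerSeries (Fin n) κ),
            IsUnit v ∧ φ (ser p (run p c₀ i t 0)) = v ^ p * ser p (run p c₀ i t r) + g ^ p := by
  intro h
  have key := h 2 Nat.prime_two 1 one_pos (ZMod 2) (fun A : Fin 1 → ℕ => if A = ![3] then (1 : ZMod 2) else 0) (fun _ => 0) (fun _ _ => 0) 0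
    (fun m hm => by
      obtain rfl : m = 0 := Nat.le_zero.mp hm
      exact ⟨isol_ucube, multP_ucube⟩)
  exact key (pairIso_refl 2 two_ne_zero _)


end Summit.ResolutionOfSingularities.ResolutionOfSingularities.Theorems.NoPeriodicIsolatedAtom.Negative

end
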